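import Literature.Probability.LatticeModels.CriticalFKIsingArmVanishes
import Literature.Probability.LatticeModels.CriticalTwoPointLower
import Literature.Probability.LatticeModels.GibbsStatesProofs
import Literature.Barriers.CriticalPhenomena.RandomClusterFirstOrderProofs
import HarnessLib

/-!
# The FK–Ising dictionary on `ℤ^d` at `q = 2`: `θ¹(1 - e^{-2β}, 2) = m*(β)`, `p_c(2) = 1 - e^{-2β_c}`, and `θ¹(p_c(2), 2) = 0` for `d ≥ 3`

Topic `Literature/Probability/LatticeModels`. Theorem-only file (no definitions, no named facts).
For the wired random-cluster quantities of the tree (`thetaWiredBox`, `thetaWired = θ¹`,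
`rcCriticalProb = p_c(q)`, `Literature/Barriers/CriticalPhenomena/RandomClusterFirstOrder.lean`) and the
nearest-neighbour Ising model on `ℤ^d` (`spontaneousMagnetization = m*`, `criticalBeta = β_c`,
`IsingThermodynamics.lean`; `fkIsingParam β = 1 - e^{-2β}`, `RandomCluster.lean`, the Edwards–Sokal
parameter for `±1` spins):

* `thetaWired_fkIsingParam_two_eq_spontaneousMagnetization` — `θ¹(1 - e^{-2β}, 2) = m*(β)` for
  `β ≥ 0`, `d ≥ 1` (Grimmett 2006, Thm. (5.17), eq. (5.19) at `q = 2`): both sides are the limit of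
  `φ¹_{Λ_{n+1},p,2}(0 ↔ ∂Λ_{n+1}) = ⟨σ_0⟩⁺_{Λ_n;β}` (`thetaWiredBox_succ_eq_isingCorr_plus`,
  `tendsto_thetaWiredBox_succ`, `tendsto_isingCorr_plus_box`);
* `rcCriticalProb_two_eq_fkIsingParam_criticalBeta` — `p_c(2) = 1 - e^{-2β_c(d)}` for `d ≥ 2`
  (Grimmett 2006, (5.2) with Thm. (5.17): the two critical points correspond under the monotone
  reparametrisation `β ↦ 1 - e^{-2β}`; uses `m*(β) = 0` for `β < β_c` and `m*(β) > 0` for `β > β_c`,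
  both tree theorems, and NOT the value at `β_c`);
* `thetaWired_rcCriticalProb_two_eq_zero` — **`θ¹(p_c(2), 2) = 0` on `ℤ^d`, `d ≥ 3`**: the wired
  FK–Ising model does not percolate at its critical point, i.e. the `q = 2` random-cluster transition
  on `ℤ^d`, `d ≥ 3`, is continuous (Aizenman–Duminil-Copin–Sidoravicius 2015, Thm. 1.2 with Cor. 1.5(1),
  `m*(β_c) = 0`, tree theorem `spontaneousMagnetization_criticalBeta_eq_zero_holds`, read through (5.19)).
  Contrast: `RandomClusterFirstOrder_holds` (`θ¹(p_c(q), q) > 0` for `q > Q(d)`).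

## References

* G. Grimmett, *The Random-Cluster Model*, Springer 2006: (5.1)–(5.4), Prop. (5.11), Thm. (5.17)
  eqs. (5.18)–(5.19); Thm. 1.16. [Grimmett2006]
* M. Aizenman, H. Duminil-Copin, V. Sidoravicius, *Random currents and continuity of Ising model's
  spontaneous magnetization*, Comm. Math. Phys. 334 (2015) 719–742, Thm. 1.2, Cor. 1.4, Cor. 1.5(1).
  [AizenmanDuminilCopinSidoraviciusCMP2015]
-/

noncomputable section

namespace Literature.Probability.LatticeModels

open Filter Topology Literature.Barriers.CriticalPhenomena

variable {d : ℕ}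

/-! ### The Edwards–Sokal parameter `p = 1 - e^{-2β}` as a reparametrisation -/

/-- `β ↦ 1 - e^{-2β}` is strictly increasing. [cite: Grimmett2006, Thm. 1.16 (the parametrisation p = 1 - e^{-β J})] -/
theorem fkIsingParam_strictMono : StrictMono fkIsingParam := by
  intro a b hab
  have h : Real.exp (-2 * b) < Real.exp (-2 * a) := Real.exp_lt_exp.2 (by linarith)
  simp only [fkIsingParam]
  linarith

/-- The inverse parametrisation: for `p < 1`, `β(p) = -log(1 - p)/2` satisfies `1 - e^{-2β(p)} = p`.
[cite: Grimmett2006, Thm. 1.16 (the parametrisation p = 1 - e^{-β J})] -/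
theorem fkIsingParam_neg_log_div_two {p : ℝ} (hp : p < 1) :
    fkIsingParam (-(Real.log (1 - p)) / 2) = p := by
  have h1 : 0 < 1 - p := by linarith
  simp only [fkIsingParam]
  rw [show -2 * (-(Real.log (1 - p)) / 2) = Real.log (1 - p) by ring, Real.exp_log h1]
  ring

/-- `β(p) = -log(1 - p)/2 ≥ 0` for `0 ≤ p < 1`. [cite: Grimmett2006, Thm. 1.16 (the parametrisation p = 1 - e^{-β J})] -/
theorem neg_log_div_two_nonneg {p : ℝ} (hp0 : 0 ≤ p) (hp1 : p < 1) :
    0 ≤ -(Real.log (1 - p)) / 2 := by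
  have h : Real.log (1 - p) ≤ 0 := Real.log_nonpos (by linarith) (by linarith)
  linarith

/-! ### `θ¹(1 - e^{-2β}, 2) = m*(β)` -/

/-- **Grimmett 2006, Thm. (5.17), eq. (5.19) at `q = 2`**: the wired FK–Ising percolation
probability at `p = 1 - e^{-2β}` is the Ising spontaneous magnetisation, `θ¹(p, 2) = m*(β)`
(`β ≥ 0`, `d ≥ 1`). Both are limits of the same sequence `φ¹_{Λ_{n+1},p,2}(0 ↔ ∂Λ_{n+1}) =
⟨σ_0⟩⁺_{Λ_n;β,0}` (Edwards–Sokal with wired/plus boundary). [cite: Grimmett2006, Thm. (5.17), eq. (5.19)] -/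
theorem thetaWired_fkIsingParam_two_eq_spontaneousMagnetization (hd : 0 < d) {β : ℝ} (hβ : 0 ≤ β) :
    thetaWired d (fkIsingParam β) 2 = spontaneousMagnetization d β := by
  have hp : fkIsingParam β ∈ Set.Icc (0 : ℝ) 1 := fkIsingParam_mem_Icc hβ
  have h1 : Tendsto (fun n : ℕ => thetaWiredBox d (fkIsingParam β) 2 (n + 1)) atTop
      (𝓝 (thetaWired d (fkIsingParam β) 2)) :=
    tendsto_thetaWiredBox_succ d hp (by norm_num)
  have h2 : Tendsto (fun n : ℕ => thetaWiredBox d (fkIsingParam β) 2 (n + 1)) atTop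
      (𝓝 (spontaneousMagnetization d β)) := by
    have h := tendsto_isingCorr_plus_box (d := d) hβ 0 ({0} : Finset (Site d))
    rw [← spontaneousMagnetization_eq_plusCorr] at h
    exact h.congr fun n => (thetaWiredBox_succ_eq_isingCorr_plus hd hβ n).symm
  exact tendsto_nhds_unique h1 h2

/-! ### `p_c(2) = 1 - e^{-2β_c}` -/

/-- **The critical points correspond**: `p_c(2) = 1 - e^{-2β_c(d)}` on `ℤ^d`, `d ≥ 2`, where
`p_c(2) = sup {p ∈ [0,1] : θ¹(p,2) = 0}` (Grimmett 2006, (5.2)) and `β_c = inf {β ≥ 0 : m*(β) > 0}`.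
Proof: by (5.19), `θ¹(1 - e^{-2β}, 2) = m*(β)` vanishes for `β < β_c` and is positive for
`β > β_c`; the value at `β_c` is not used. [cite: Grimmett2006, (5.2) with Thm. (5.17), eq. (5.19)] -/
theorem rcCriticalProb_two_eq_fkIsingParam_criticalBeta (hd : 2 ≤ d) :
    rcCriticalProb d 2 = fkIsingParam (criticalBeta d) := by
  have hd0 : 0 < d := by omega
  have hβc : 0 ≤ criticalBeta d := criticalBeta_nonneg d
  have hP : fkIsingParam (criticalBeta d) ∈ Set.Icc (0 : ℝ) 1 := fkIsingParam_mem_Icc hβc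
  have hpc : rcCriticalProb d 2 ∈ Set.Icc (0 : ℝ) 1 := rcCriticalProb_mem_Icc d 2
  have h2 : (1 : ℝ) ≤ 2 := by norm_num
  refine le_antisymm ?_ ?_
  · -- `p_c(2) ≤ 1 - e^{-2β_c}`: otherwise some `p` strictly between them has `θ¹(p,2) = 0`
    -- (below `p_c`) and `θ¹(p,2) = m*(β(p)) > 0` (`β(p) > β_c`).
    by_contra h
    push Not at h
    obtain ⟨p, hPp, hppc⟩ := exists_between h
    have hp1 : p < 1 := hppc.trans_le hpc.2
    have hp0 : 0 ≤ p := hP.1.trans hPp.le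
    set β := -(Real.log (1 - p)) / 2 with hβdef
    have hβ0 : 0 ≤ β := neg_log_div_two_nonneg hp0 hp1
    have hpβ : fkIsingParam β = p := fkIsingParam_neg_log_div_two hp1
    have hlt : criticalBeta d < β := by
      refine fkIsingParam_strictMono.lt_iff_lt.1 ?_
      rw [hpβ]; exact hPp
    have hpos : 0 < spontaneousMagnetization d β :=
      spontaneousMagnetization_pos_of_criticalBeta_lt_holds (d := d) (β := β) hd hlt
    have hzero : thetaWired d p 2 = 0 := thetaWired_eq_zero_of_lt_rcCriticalProb h2 hp0 hppc
    rw [← hpβ, thetaWired_fkIsingParam_two_eq_spontaneousMagnetization hd0 hβ0] at hzero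
    linarith
  · -- `1 - e^{-2β_c} ≤ p_c(2)`: otherwise some `p` strictly between them has `θ¹(p,2) > 0`
    -- (above `p_c`) and `θ¹(p,2) = m*(β(p)) = 0` (`β(p) < β_c`).
    by_contra h
    push Not at h
    obtain ⟨p, hpcp, hpP⟩ := exists_between h
    have hp1 : p < 1 := hpP.trans_le hP.2
    have hp0 : 0 ≤ p := hpc.1.trans hpcp.le
    set β := -(Real.log (1 - p)) / 2 with hβdef
    have hβ0 : 0 ≤ β := neg_log_div_two_nonneg hp0 hp1
    have hpβ : fkIsingParam β = p := fkIsingParam_neg_log_div_two hp1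
    have hlt : β < criticalBeta d := by
      refine fkIsingParam_strictMono.lt_iff_lt.1 ?_
      rw [hpβ]; exact hpP
    have hzero : spontaneousMagnetization d β = 0 :=
      spontaneousMagnetization_eq_zero_of_lt_criticalBeta_holds (d := d) (β := β) hβ0 hlt
    have hpos : 0 < thetaWired d p 2 := thetaWired_pos_of_rcCriticalProb_lt ⟨hp0, hp1.le⟩ hpcp
    rw [← hpβ, thetaWired_fkIsingParam_two_eq_spontaneousMagnetization hd0 hβ0] at hpos
    linarith

/-! ### Continuity of the wired FK–Ising transition on `ℤ^d`, `d ≥ 3` -/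

/-- **`θ¹(p_c(2), 2) = 0` on `ℤ^d` for every `d ≥ 3`** (Aizenman–Duminil-Copin–Sidoravicius 2015,
Thm. 1.2 with Cor. 1.5(1): the spontaneous magnetisation of the nearest-neighbour Ising model is
continuous at `β_c` for `d ≥ 3` — tree theorem `spontaneousMagnetization_criticalBeta_eq_zero_holds`,
by the infrared bound and the random-current representation — combined with Grimmett 2006,
Thm. (5.17) eq. (5.19), `θ¹ = m*`, and `p_c(2) = 1 - e^{-2β_c}`): the wired random-cluster model with
`q = 2` does not percolate at its critical point. For `q > Q(d)` the opposite holds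
(`RandomClusterFirstOrder_holds`). [cite: AizenmanDuminilCopinSidoraviciusCMP2015, Thm. 1.2 with Cor. 1.5 (1)] [cite: Grimmett2006, Thm. (5.17), eq. (5.19)] -/
theorem thetaWired_rcCriticalProb_two_eq_zero (hd : 3 ≤ d) :
    thetaWired d (rcCriticalProb d 2) 2 = 0 := by
  rw [rcCriticalProb_two_eq_fkIsingParam_criticalBeta (by omega),
    thetaWired_fkIsingParam_two_eq_spontaneousMagnetization (by omega) (criticalBeta_nonneg d)]
  exact spontaneousMagnetization_criticalBeta_eq_zero_holds hd

/-- The same at the Edwards–Sokal parameter: `θ¹(1 - e^{-2β_c(d)}, 2) = 0`, `d ≥ 3`.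
[cite: AizenmanDuminilCopinSidoraviciusCMP2015, Thm. 1.2 with Cor. 1.5 (1)] -/
theorem thetaWired_fkIsingParam_criticalBeta_two_eq_zero (hd : 3 ≤ d) :
    thetaWired d (fkIsingParam (criticalBeta d)) 2 = 0 := by
  rw [thetaWired_fkIsingParam_two_eq_spontaneousMagnetization (by omega) (criticalBeta_nonneg d)]
  exact spontaneousMagnetization_criticalBeta_eq_zero_holds hd

end Literature.Probability.LatticeModels

end
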